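import Summits.CriticalPhenomena.CardyFormulaZ2.Theses.ModulusResponse
import Summits.CriticalPhenomena.CardyFormulaZ2.Theorems.CardySelfDualSegmentUniformBoxCrossingKernelIff
import Summits.CriticalPhenomena.CardyFormulaZ2.Theorems.CardySelfDualSegmentUniformBoxCrossingOfMonotoneChirality
import Summits.CriticalPhenomena.CardyFormulaZ2.Theorems.ModulusResponseSegmentRSWStubCellLaw
import Summits.CriticalPhenomena.CardyFormulaZ2.Theorems.ModulusResponseSegmentRSWStubNegCrossing
import Summits.CriticalPhenomena.CardyFormulaZ2.Theorems.ModulusResponseSegmentRSWStubSmallBoxes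
import HarnessLib

/-!
# `SegmentRSW ↔ NonSlantStatement ↔ UniformBoxCrossing` (crux stmt-CriticalPhenomena-6470, line `birth`)

Sorry-free dividend of line `birth` (`Cruxes/SegmentRSW/Lines/birth.lean`) for the crux
`Summit.CriticalPhenomena.CardyFormulaZ2.Theses.ModulusResponse.SegmentRSW` (uniform RSW on the
self-dual cell segment `μ_u`, `u ∈ [0,1/2]`). With the three mechanical stubs of the line landed —
`stub_cellLaw` (`μ_u = (cornerPercolation ⟨2u⟩).map (relabel neg)`), `stub_negCrossing`
(point-reflection invariance of rectangle crossings under every `M_t`), `stub_smallBoxes` (finite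
energy, every fixed `n`) — the crux is EQUIVALENT, in Lean, to the sibling crux's registered kernel
`NonSlantStatement` (t-uniform Non-Slant lemma for the corner models, Bollobás–Riordan 2010
Lemma 5.2 without the mirror) and hence to the sibling crux
`Summit.CriticalPhenomena.CardyFormulaZ2.Theses.CardySelfDualSegment.UniformBoxCrossing`
(stmt-CriticalPhenomena-5476) itself (`uniformBoxCrossing_iff_nonSlant`):

* `segmentRSW_of_nonSlant` — kernel ⟹ crux: the landed Bollobás–Riordan engine of the sibling line
  (`stub_assembly … ⟶ TBStatement ⟶ stub_brChain_of_tbBound ⟶ stub_join`) gives one constant for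
  the hard-way `2:1` crossings `M_t(LR([0,2n]×[0,n]))`, `n ≥ n₀`, all `t`; the scales `n < n₀` are
  absorbed by `stub_smallBoxes`; transposition turns `TB(n,2n)` into `LR(2n,n)`; the transfer
  (`cellCornerTransfer`) moves the bound to `μ_u`, `t = 2u`.
* `nonSlant_of_segmentRSW` — crux ⟹ kernel: instantiate the crux at the pinned family itself, move
  the `2:1` bound back to `M_t` (`u = t/2`), shrink `LR([0,2k]×[0,k])`, `k = ⌈n/2⌉`, to
  `LR([0,n]×[0,⌊3n/5⌋])` (antitone in the width, monotone in the height; `n ≥ 5`), transpose, and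
  observe that a vertical crossing of `[0,⌊3n/5⌋]×[0,n]` is a non-slant crossing of the square
  (`tbCrossing_subset_nonSlantSet`).

So ONE proof of the kernel closes both cruxes (`segmentRSW_iff_uniformBoxCrossing`), every
negative result on `UniformBoxCrossing` (`Theorems/UniformBoxCrossing/Negative/*`) is a negative
result on the hypotheses any proof of `SegmentRSW` may use, and the sibling line's reshaped kernels
— ENDPOINT DOMINATION and MONOTONE CHIRALITY for the turned `2:1` boxes
(`uniformBoxCrossing_of_endpointDomination`, `uniformBoxCrossing_of_monotoneChirality`) — close
`SegmentRSW` as well (`segmentRSW_of_endpointDomination`, `segmentRSW_of_monotoneChirality`).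
-/

noncomputable section

namespace Summit.CriticalPhenomena.CardyFormulaZ2.Cruxes.SegmentRSW.Birth

open MeasureTheory ProbabilityTheory
open Literature.Probability.Percolation Literature.Probability.LatticeModels
open Summit.CriticalPhenomena.CardyFormulaZ2.Theses.ModulusResponse
open Summit.CriticalPhenomena.CardyFormulaZ2.Theses.CardySelfDualSegment
open Summit.CriticalPhenomena.CardyFormulaZ2.Cruxes.UniformBoxCrossing.NonSlantLine
open Complex Literature.Probability.Percolation.TrackExchange

/-- **Transfer** (the registered `stub_cellCornerTransfer` of the birth skeleton, proved from the
landed `stub_cellLaw` + `stub_negCrossing`): for the cell family `μ` pinned by the crux's defining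
equation and `u ∈ [0,1/2]`, every lattice rectangle `[0,M]×[0,N]` has the same left–right and the
same top–bottom open-crossing probability under `μ_u` as under `M_{2u} = cornerPercolation ⟨2u⟩`.
[folklore] -/
theorem cellCornerTransfer :
    ∀ μ : ℝ → Measure (BondConfig (Site 2)),
      (∀ u, μ u = Measure.map
        (fun p : Set (Site 2) × Set (Site 2) ↦
          {e | ∃ m, (m ∈ p.1 ∧ e = s(m - Pi.single 0 1, m)) ∨
            ((m ∈ p.1 ↔ m ∉ p.2) ∧ e = s(m - Pi.single 1 1, m))})
        ((setBernoulli Set.univ half).prod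
          (setBernoulli Set.univ (Set.projIcc 0 1 zero_le_one u)))) →
      ∀ u ∈ Set.Icc (0 : ℝ) (1 / 2), ∀ M N : ℕ,
        (μ u).real (lrCrossing M N) =
            (cornerPercolation (Set.projIcc 0 1 zero_le_one (2 * u))).real (lrCrossing M N) ∧
          (μ u).real (tbCrossing M N) =
            (cornerPercolation (Set.projIcc 0 1 zero_le_one (2 * u))).real (tbCrossing M N) := by
  intro μ hμ u hu M N
  rw [hμ u, stub_cellLaw u hu]
  exact stub_negCrossing _ M N

/-- **Composition logic, hypothesis form.** From a transfer hypothesis, the kernel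
`NonSlantStatement` and a finite-size hypothesis to the body of `SegmentRSW`, verbatim: the kernel
is fed to the landed Bollobás–Riordan engine of the sibling line (`stub_assembly`, `stub_explore`,
`stub_cover`, `stub_smallGap`, `stub_junction`, `stub_link` ⟶ `TBStatement`;
`stub_brChain_of_tbBound`, `stub_join` ⟶ hard-way `2:1` crossings for `n ≥ n₀`, one constant for
all `t`); the scales `n < n₀` are absorbed by the finite-size hypothesis (induction on `n₀`);
`TB(n,2n)` is `LR(2n,n)` by `cornerPercolation_real_tbCrossing`; the bound is moved to `μ_u`,
`t = 2u`, by the transfer hypothesis. [cite: BollobasRiordan2010, §5.1 Thm. 5.3] -/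
theorem segmentRSW_of_hypotheses
    (hT : ∀ μ : ℝ → Measure (BondConfig (Site 2)),
      (∀ u, μ u = Measure.map
        (fun p : Set (Site 2) × Set (Site 2) ↦
          {e | ∃ m, (m ∈ p.1 ∧ e = s(m - Pi.single 0 1, m)) ∨
            ((m ∈ p.1 ↔ m ∉ p.2) ∧ e = s(m - Pi.single 1 1, m))})
        ((setBernoulli Set.univ half).prod
          (setBernoulli Set.univ (Set.projIcc 0 1 zero_le_one u)))) →
      ∀ u ∈ Set.Icc (0 : ℝ) (1 / 2), ∀ M N : ℕ,
        (μ u).real (lrCrossing M N) =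
            (cornerPercolation (Set.projIcc 0 1 zero_le_one (2 * u))).real (lrCrossing M N) ∧
          (μ u).real (tbCrossing M N) =
            (cornerPercolation (Set.projIcc 0 1 zero_le_one (2 * u))).real (tbCrossing M N))
    (hNS : NonSlantStatement)
    (hF : ∀ n : ℕ, 1 ≤ n → ∃ c : ℝ, 0 < c ∧ ∀ t : unitInterval,
      c ≤ (cornerPercolation t).real (lrCrossing (2 * n) n)) :
    ∀ μ : ℝ → Measure (BondConfig (Site 2)),
      (∀ u, μ u = Measure.map
        (fun p : Set (Site 2) × Set (Site 2) ↦
          {e | ∃ m, (m ∈ p.1 ∧ e = s(m - Pi.single 0 1, m)) ∨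
            ((m ∈ p.1 ↔ m ∉ p.2) ∧ e = s(m - Pi.single 1 1, m))})
        ((setBernoulli Set.univ half).prod
          (setBernoulli Set.univ (Set.projIcc 0 1 zero_le_one u)))) →
      ∃ c : ℝ, 0 < c ∧ ∀ u ∈ Set.Icc (0 : ℝ) (1 / 2), ∀ n : ℕ, 1 ≤ n →
        c ≤ (μ u).real (lrCrossing (2 * n) n) ∧ c ≤ (μ u).real (tbCrossing n (2 * n)) := by
  intro μ hμ
  -- (1) the landed Bollobás–Riordan engine: Non-Slant ⇒ hard-way `2:1` crossings for `n ≥ n₀`.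
  have hTB : TBStatement :=
    stub_assembly hNS stub_explore (stub_smallGap (stub_cover stub_explore.1) stub_explore)
      stub_junction stub_link
  obtain ⟨c₁, hc₁, n₀, hHW⟩ := stub_join (stub_brChain_of_tbBound hTB)
  -- (2) the finitely many scales `1 ≤ n < m`: one constant, by induction on `m`.
  have hfin : ∀ m : ℕ, ∃ c : ℝ, 0 < c ∧ ∀ n : ℕ, 1 ≤ n → n < m → ∀ t : unitInterval,
      c ≤ (cornerPercolation t).real (lrCrossing (2 * n) n) := by
    intro m
    induction m with
    | zero => exact ⟨1, one_pos, fun n _ h => absurd h (Nat.not_lt_zero n)⟩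
    | succ m ih =>
      obtain ⟨c, hc, h⟩ := ih
      rcases Nat.eq_zero_or_pos m with hm0 | hm
      · exact ⟨1, one_pos, fun n hn hlt => absurd hlt (by omega)⟩
      · obtain ⟨c', hc', h'⟩ := hF m (by omega)
        refine ⟨min c c', lt_min hc hc', fun n hn hlt t => ?_⟩
        rcases Nat.lt_or_ge n m with hlt' | hge
        · exact (min_le_left _ _).trans (h n hn hlt' t)
        · have hnm : n = m := by omega
          subst hnm
          exact (min_le_right _ _).trans (h' t)
  obtain ⟨c₂, hc₂, hsmall⟩ := hfin n₀
  -- (3) one constant for every `n ≥ 1` and every `t`.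
  have hcorner : ∀ (t : unitInterval) (n : ℕ), 1 ≤ n →
      min c₁ c₂ ≤ (cornerPercolation t).real (lrCrossing (2 * n) n) := by
    intro t n hn
    rcases Nat.lt_or_ge n n₀ with hlt | hge
    · exact (min_le_right _ _).trans (hsmall n hn hlt t)
    · exact (min_le_left _ _).trans (hHW t n hge)
  -- (4) transfer to the cell family (`t = 2u`); `TB(n,2n) = LR(2n,n)` for `M_t` by transposition.
  refine ⟨min c₁ c₂, lt_min hc₁ hc₂, fun u hu n hn => ⟨?_, ?_⟩⟩
  · rw [(hT μ hμ u hu (2 * n) n).1]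
    exact hcorner _ n hn
  · rw [(hT μ hμ u hu n (2 * n)).2, cornerPercolation_real_tbCrossing]
    exact hcorner _ n hn

/-- **Kernel ⟹ crux**: the t-uniform Non-Slant lemma for the corner models implies `SegmentRSW`
(BY NAME). [cite: BollobasRiordan2010, §5.1 Thm. 5.3] -/
theorem segmentRSW_of_nonSlant (hNS : NonSlantStatement) : SegmentRSW :=
  segmentRSW_of_hypotheses cellCornerTransfer hNS stub_smallBoxes

/-- **The crux read on the corner models**: `SegmentRSW` gives one constant `c > 0` with
`M_t(LR([0,2n]×[0,n])) ≥ c` for every `t ∈ [0,1]` and `n ≥ 1` (instantiate the crux at the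
pinned family itself and transfer back with `u = t/2`). [folklore] -/
theorem cornerHardWay_of_segmentRSW (h : SegmentRSW) :
    ∃ c : ℝ, 0 < c ∧ ∀ (t : unitInterval) (n : ℕ), 1 ≤ n →
      c ≤ (cornerPercolation t).real (lrCrossing (2 * n) n) := by
  have hdef : ∀ u : ℝ,
      (fun u : ℝ => Measure.map
        (fun p : Set (Site 2) × Set (Site 2) ↦
          ({e | ∃ m, (m ∈ p.1 ∧ e = s(m - Pi.single 0 1, m)) ∨
            ((m ∈ p.1 ↔ m ∉ p.2) ∧ e = s(m - Pi.single 1 1, m))} : BondConfig (Site 2)))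
        ((setBernoulli Set.univ half).prod
          (setBernoulli Set.univ (Set.projIcc 0 1 zero_le_one u)))) u =
      Measure.map
        (fun p : Set (Site 2) × Set (Site 2) ↦
          ({e | ∃ m, (m ∈ p.1 ∧ e = s(m - Pi.single 0 1, m)) ∨
            ((m ∈ p.1 ↔ m ∉ p.2) ∧ e = s(m - Pi.single 1 1, m))} : BondConfig (Site 2)))
        ((setBernoulli Set.univ half).prod
          (setBernoulli Set.univ (Set.projIcc 0 1 zero_le_one u))) := fun _ => rfl
  obtain ⟨c, hc, hbd⟩ := h _ hdef
  refine ⟨c, hc, fun t n hn => ?_⟩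
  have hu : ((t : ℝ) / 2) ∈ Set.Icc (0 : ℝ) (1 / 2) :=
    ⟨by linarith [unitInterval.nonneg t], by linarith [unitInterval.le_one t]⟩
  have key := (hbd ((t : ℝ) / 2) hu n hn).1
  rw [(cellCornerTransfer _ hdef _ hu (2 * n) n).1] at key
  have h2 : (2 : ℝ) * ((t : ℝ) / 2) = t := by ring
  have ht : Set.projIcc 0 1 zero_le_one (2 * ((t : ℝ) / 2)) = t := by
    rw [h2]
    exact Set.projIcc_val zero_le_one t
  rwa [ht] at key

/-- **Crux ⟹ kernel**: `SegmentRSW` implies the t-uniform Non-Slant lemma (with `n₀ = 5`): shrink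
`LR([0,2k]×[0,k])`, `k = ⌈n/2⌉ ≤ ⌊3n/5⌋`, to `LR([0,n]×[0,⌊3n/5⌋])`, transpose, and read a vertical
crossing of `[0,⌊3n/5⌋]×[0,n]` as a non-slant crossing of `[0,n]²`.
[cite: BollobasRiordan2010, §5.1 Lemma 5.2] -/
theorem nonSlant_of_segmentRSW (h : SegmentRSW) : NonSlantStatement := by
  obtain ⟨c, hc, hHW⟩ := cornerHardWay_of_segmentRSW h
  refine ⟨c, hc, 5, fun t n hn => ?_⟩
  have h1 : c ≤ (cornerPercolation t).real (lrCrossing (2 * ((n + 1) / 2)) ((n + 1) / 2)) :=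
    hHW t _ (by omega)
  have h2 : (cornerPercolation t).real (lrCrossing (2 * ((n + 1) / 2)) ((n + 1) / 2)) ≤
      (cornerPercolation t).real (lrCrossing n ((n + 1) / 2)) :=
    cornerPercolation_real_lrCrossing_anti_left t (by omega) _
  have h3 : (cornerPercolation t).real (lrCrossing n ((n + 1) / 2)) ≤
      (cornerPercolation t).real (lrCrossing n (3 * n / 5)) :=
    measureReal_mono (lrCrossing_mono_right n (by omega))
  have h4 : (cornerPercolation t).real (lrCrossing n (3 * n / 5)) ≤
      (cornerPercolation t).real {ω | ∃ x ∈ bottomSide n n, ∃ y ∈ topSide n n,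
        5 * |y 0 - x 0| ≤ 3 * (n : ℤ) ∧ ω ∈ openConnIn (↑(rectangle n n)) x y} := by
    rw [← cornerPercolation_real_tbCrossing t n (3 * n / 5)]
    exact measureReal_mono (tbCrossing_subset_nonSlantSet (by omega) (by omega))
  exact h1.trans (h2.trans (h3.trans h4))

/-- **`SegmentRSW ↔ NonSlantStatement`**: the crux of route ModulusResponse is, in Lean, exactly the
sibling line's registered kernel. [cite: BollobasRiordan2010, §5.1 Thm. 5.3] -/
theorem segmentRSW_iff_nonSlant : SegmentRSW ↔ NonSlantStatement :=
  ⟨nonSlant_of_segmentRSW, segmentRSW_of_nonSlant⟩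

/-- **`SegmentRSW ↔ UniformBoxCrossing`**: the two cruxes stmt-CriticalPhenomena-6470 (route
ModulusResponse) and stmt-CriticalPhenomena-5476 (route CardySelfDualSegment) are equivalent; one
proof of either closes both. [cite: BollobasRiordan2010, §5.1 Thm. 5.3] -/
theorem segmentRSW_iff_uniformBoxCrossing : SegmentRSW ↔ UniformBoxCrossing :=
  segmentRSW_iff_nonSlant.trans uniformBoxCrossing_iff_nonSlant.symm

/-- `UniformBoxCrossing ⟹ SegmentRSW` (the direction the ModulusResponse route consumes).
[cite: BollobasRiordan2010, §5.1 Thm. 5.3] -/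
theorem segmentRSW_of_uniformBoxCrossing (h : UniformBoxCrossing) : SegmentRSW :=
  segmentRSW_iff_uniformBoxCrossing.2 h

/-- **`SegmentRSW` from ENDPOINT DOMINATION** (the sibling line's registered kernel
`stub_endpointDomination`, stmt-CriticalPhenomena-5476 line `Sketch`): if for every `t` the
u-crossings of the turned `m × 2m` boxes are at least as likely under `M_t` as under `M_0` and the
w-crossings of the turned `2m × m` boxes at least as likely as under `M_1` (eventually in `m`, every
integer position), then `SegmentRSW`. [cite: BollobasRiordan2010, §5.1 Thm. 5.3] -/
theorem segmentRSW_of_endpointDomination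
    (hED : ∃ m₁ : ℕ, ∀ m : ℕ, m₁ ≤ m → ∀ (A B : ℤ) (t : unitInterval),
      (cornerPercolation 0).real (embTBCrossing (fun v => zDia v - ((A : ℂ) + (B : ℂ) * I)) m (2 * m)) ≤
        (cornerPercolation t).real (embTBCrossing (fun v => zDia v - ((A : ℂ) + (B : ℂ) * I)) m (2 * m)) ∧
      (cornerPercolation 1).real (embRectCrossing (fun v => zDia v - ((A : ℂ) + (B : ℂ) * I)) (2 * m) m) ≤
        (cornerPercolation t).real (embRectCrossing (fun v => zDia v - ((A : ℂ) + (B : ℂ) * I)) (2 * m) m)) :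
    SegmentRSW :=
  segmentRSW_of_uniformBoxCrossing (uniformBoxCrossing_of_endpointDomination hED)

/-- **`SegmentRSW` from MONOTONE CHIRALITY** (`t ↦ P_t(u-crossing of the turned m × 2m box)`
non-decreasing and `t ↦ P_t(w-crossing of the turned 2m × m box)` non-increasing on `[0,1]`,
eventually in `m`, every integer position — the natural conjectured form of the sibling dossiers,
exact for `m ≤ 3`). [cite: BollobasRiordan2010, §5.1 Thm. 5.3] -/
theorem segmentRSW_of_monotoneChirality
    (hMC : ∃ m₁ : ℕ, ∀ m : ℕ, m₁ ≤ m → ∀ (A B : ℤ) (t t' : unitInterval), t ≤ t' →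
      (cornerPercolation t).real (embTBCrossing (fun v => zDia v - ((A : ℂ) + (B : ℂ) * I)) m (2 * m)) ≤
        (cornerPercolation t').real (embTBCrossing (fun v => zDia v - ((A : ℂ) + (B : ℂ) * I)) m (2 * m)) ∧
      (cornerPercolation t').real (embRectCrossing (fun v => zDia v - ((A : ℂ) + (B : ℂ) * I)) (2 * m) m) ≤
        (cornerPercolation t).real (embRectCrossing (fun v => zDia v - ((A : ℂ) + (B : ℂ) * I)) (2 * m) m)) :
    SegmentRSW :=
  segmentRSW_of_uniformBoxCrossing (uniformBoxCrossing_of_monotoneChirality hMC)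

end Summit.CriticalPhenomena.CardyFormulaZ2.Cruxes.SegmentRSW.Birth

end
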